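import Summits.BirchSwinnertonDyer.BirchSwinnertonDyer.Theorems.SignedLowerHalvesSmallImageLowerHalfBothSignsLambdaLowerThreeNsThetaPartnerArithmeticHalfExport
import Literature.NumberTheory.GaloisRepresentations.GrossencharakterSharpModulus
import Literature.NumberTheory.EllipticCurves.CMNewformGamma0NebentypusProofs
import Literature.NumberTheory.EllipticCurves.QuadraticTwistRamifiedLocalPolynomialProofs
import HarnessLib

/-!
# K0₂″ — the arithmetic half with a SHARP modulus (producer′ of the «ROAD-𝔪» repair, crux L `SmallImageLowerHalfBothSigns`, stmt-BirchSwinnertonDyer-23599, line `rtt_w3`)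

INPUTS hand `bsd-inputs-honda-p1` g32 under LEAD `cruxlead-stmt-BirchSwinnertonDyer-23599` (BRIEF-ROADGAP-g15 §3(c); director (873)(a)); helper
`--supports stmt-BirchSwinnertonDyer-23599`; THEOREMS ONLY, no `sorry`; ADDITIVE successor of `…LambdaLowerThreeNsThetaPartnerArithmeticHalfExport` (not edited).
BSD is not proved here; inputs typed/proved here make the conditional line unconditional AS TYPED only.

WHY. `exists_arithmeticHalf_classwide` exports the theta partner's Grössencharakter `ψ` with the CRUDE modulus `𝔪 = (t)`, `t = d_K·B^m` (a common
multiple of the bad primes), so `IsGrossencharakter 𝔪 …`/`hneb`/`hbad` say nothing at the primes of `𝔪` where `ψ` is unramified, whereas the frame of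
S4‴ (Kato's F1, (R)) needs the avatar `θ` of `ψ` RAMIFIED at every prime of the modulus away from `p`. This file SHARPENS the export without re-running
the construction (`IsGrossencharakter.exists_sharp`, Neukirch VII (6.11)–(6.14): `𝔪′ = ∏_{w ∈ ram ω} 𝔭_w^{e_w+1}` for the idelic lift `ω` of `ψ`,
`ψ′ = ω(ϖ_·)`, `ψ′ = ψ` off `𝔪`, `supp 𝔪′ ⊆ supp 𝔪`, `supp 𝔪′ = ram χ` for EVERY Hecke character `χ` realising `ψ′`) and re-derives the clauses:
* §1 `nebentypus_of_sharp` — `ψ′((n)) = (d_K/n)·n` for odd `n` prime to `|d_K|·N𝔪′` (MORE `n` than before): odd `n₁ ≡ n (mod 4|d_K|N𝔪′)` prime to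
  `N𝔪` (`ZMod.unitsMap_surjective`), ray relation mod `𝔪′`, `ψ′((n₁)) = ψ((n₁))`, `(d_K/n₁) = (d_K/n)` (`jacobiSym.mod_right`).
* §2 ★ `le_asIdeal_of_discr_mem` — **every prime of `d_K` divides the modulus** of ANY Grössencharakter of type `(σ, 0)` on an imaginary quadratic
  field with the trivial-Nebentypus clause: else `ℓ ∤ N𝔪` for the ramified `ℓ` (one prime above it), `ψ((m)) = κ(m)·m` for `m` prime to `|d_K|N𝔪`
  (`idealPow_span_natCast_eq_kroneckerChar_mul_pow`) and `= m` for `m ≡ 1 (N𝔪)` (ray relation) make the Kronecker character `κ` factor through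
  `gcd(|d_K|, N𝔪) < |d_K|` (`DirichletCharacter.factorsThrough_iff_ker_unitsMap`, CRT) — against its primitivity (Ribet §3 `η = φ`; Cox 1.14).
* §3 ★★ `exists_arithmeticHalf_classwide_sharp` — `exists_arithmeticHalf_classwide` VERBATIM for the sharp pair, plus (prim′) and (dK′) before `∃ Φ k e₀ …`.

References: [NeukirchANT1999] Ch. VII §6 (6.11)–(6.14); [Ribet1977Nebentypus] §3; [Cox2013] §1.C Lemma 1.14; [Marcus2018] Ch. 3 Thm. 25, Thm. 34.
-/

set_option autoImplicit false
set_option linter.dupNamespace false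
noncomputable section

open scoped Classical NumberField MatrixGroups nonZeroDivisors ComplexConjugate
open IsDedekindDomain IsDedekindDomain.HeightOneSpectrum Field Matrix NumberField WeierstrassCurve Filter
  Literature.NumberTheory.EllipticCurves Literature.NumberTheory.GaloisRepresentations Rat.HeightOneSpectrum
  Literature.NumberTheory.EllipticCurves.Rank1Residual Summit.BirchSwinnertonDyer.Rank1Residual
  Literature.NumberTheory.LFunctions Literature.NumberTheory.GaloisRepresentations.HeckeCharacter
  Literature.NumberTheory.GaloisRepresentations.IsNonarchimedeanLocalField
  Literature.NumberTheory.GaloisRepresentations.ModPGaloisRep ValuativeRel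
  Literature.NumberTheory.EllipticCurves.ModularForms Literature.NumberTheory.Automorphic
  Summit.BirchSwinnertonDyer.BirchSwinnertonDyer.Theorems.HeckeThetaPartner

namespace Summit.BirchSwinnertonDyer.BirchSwinnertonDyer.Theorems.SmallImageLambdaLowerThreeNsThetaPartner

section Sharp
variable {K : Type} [Field K] [NumberField K]

/-- `(n) + 𝔪 = 1` for a natural number `n` prime to `N𝔪` (`N𝔪 ∈ 𝔪`). [folklore] -/
private theorem isCoprime_span_natCast_of_coprime_absNorm' {𝔪 : Ideal (𝓞 K)} {n : ℕ}
    (hn : n.Coprime (Ideal.absNorm 𝔪)) : IsCoprime (Ideal.span {(n : 𝓞 K)}) 𝔪 := by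
  rw [Ideal.isCoprime_iff_exists]
  obtain ⟨u, v, huv⟩ := Nat.Coprime.isCoprime hn
  refine ⟨(u : 𝓞 K) * n, Ideal.mul_mem_left _ _ (Ideal.mem_span_singleton_self _),
    (v : 𝓞 K) * (Ideal.absNorm 𝔪 : 𝓞 K), Ideal.mul_mem_left _ _ (Ideal.absNorm_mem 𝔪), ?_⟩
  have := congrArg (fun z : ℤ => (z : 𝓞 K)) huv
  push_cast at this
  exact this

/-- A rational prime dividing `N I` (`I ≠ 0`) divides `N𝔭` for some prime `𝔭 ⊇ I` (multiplicativity of the norm over the prime factorisation).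
[folklore] -/
private theorem exists_prime_le_of_prime_dvd_absNorm {I : Ideal (𝓞 K)} (hI : I ≠ ⊥) {ℓ : ℕ} (hℓ : ℓ.Prime)
    (h : ℓ ∣ Ideal.absNorm I) : ∃ w : HeightOneSpectrum (𝓞 K), I ≤ w.asIdeal ∧ ℓ ∣ Ideal.absNorm w.asIdeal := by
  have hN : Ideal.absNorm I = ((UniqueFactorizationMonoid.normalizedFactors I).map Ideal.absNorm).prod := by
    rw [← map_multiset_prod, Ideal.prod_normalizedFactors_eq_self hI]
  rw [hN] at h
  obtain ⟨P, hP, hℓP⟩ := Prime.exists_mem_multiset_map_dvd (Nat.prime_iff.mp hℓ)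
    (s := UniqueFactorizationMonoid.normalizedFactors I) (f := fun P => Ideal.absNorm P) h
  have hPp : Prime P := UniqueFactorizationMonoid.prime_of_normalized_factor P hP
  exact ⟨⟨P, Ideal.isPrime_of_prime hPp, hPp.ne_zero⟩, Ideal.le_of_dvd (UniqueFactorizationMonoid.dvd_of_mem_normalizedFactors hP), hℓP⟩

/-- A prime `𝔭` with `ℓ ∣ N𝔭` contains `ℓ` (`N𝔭` is a power of the residue characteristic). [folklore] -/
private theorem natCast_mem_of_dvd_absNorm' {ℓ : ℕ} (hℓ : ℓ.Prime) (v : HeightOneSpectrum (𝓞 K))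
    (h : ℓ ∣ Ideal.absNorm v.asIdeal) : (ℓ : 𝓞 K) ∈ v.asIdeal := by
  haveI := v.isMaximal
  haveI : Finite (𝓞 K ⧸ v.asIdeal) := Ideal.finiteQuotientOfFreeOfNeBot v.asIdeal v.ne_bot
  letI : Field (𝓞 K ⧸ v.asIdeal) := Ideal.Quotient.field v.asIdeal
  obtain ⟨q, hqchar⟩ := CharP.exists (𝓞 K ⧸ v.asIdeal)
  have hq : q.Prime := CharP.char_is_prime (𝓞 K ⧸ v.asIdeal) q
  have hqv : (q : 𝓞 K) ∈ v.asIdeal := by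
    rw [← Ideal.Quotient.eq_zero_iff_mem, map_natCast]
    exact CharP.cast_eq_zero (𝓞 K ⧸ v.asIdeal) q
  have hqZ : Prime (q : ℤ) := Nat.prime_iff_prime_int.mp hq
  have hunder : v.asIdeal.under ℤ = Ideal.span {(q : ℤ)} := by
    haveI hmax : (Ideal.span {(q : ℤ)}).IsMaximal :=
      ((Ideal.span_singleton_prime hqZ.ne_zero).mpr hqZ).isMaximal (by simpa using hqZ.ne_zero)
    refine (hmax.eq_of_le (Ideal.IsPrime.under ℤ v.asIdeal).ne_top ?_).symm
    rw [Ideal.span_singleton_le_iff_mem, Ideal.under_def, Ideal.mem_comap, map_natCast]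
    exact hqv
  haveI : v.asIdeal.LiesOver (Ideal.span {(q : ℤ)}) := ⟨hunder.symm⟩
  have hnorm := Ideal.absNorm_eq_pow_inertiaDeg' v.asIdeal hq
  rw [hnorm] at h
  have hℓq : ℓ = q := (Nat.prime_dvd_prime_iff_eq hℓ hq).mp (hℓ.dvd_of_dvd_pow h)
  subst hℓq
  exact hqv

omit [NumberField K] in
/-- Two rational numbers in a proper ideal share a prime: `ℓ ∈ 𝔭_w`, `d ∈ 𝔭_w` (`ℓ` prime) force `ℓ ∣ d`. [folklore] -/
private theorem natCast_dvd_of_mem_of_intCast_mem {w : HeightOneSpectrum (𝓞 K)} {ℓ : ℕ} (hℓ : ℓ.Prime)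
    (hℓw : (ℓ : 𝓞 K) ∈ w.asIdeal) {d : ℤ} (hd : (d : 𝓞 K) ∈ w.asIdeal) : (ℓ : ℤ) ∣ d := by
  by_contra hnd
  have hcop : IsCoprime (ℓ : ℤ) d := Int.isCoprime_iff_gcd_eq_one.mpr (by
    rw [Int.gcd_eq_natAbs, Int.natAbs_natCast]
    exact (Nat.Prime.coprime_iff_not_dvd hℓ).mpr fun h => hnd (Int.natCast_dvd.mpr h))
  obtain ⟨a, b, hab⟩ := hcop
  have h1 : (1 : 𝓞 K) ∈ w.asIdeal := by
    have := congrArg (Int.cast : ℤ → 𝓞 K) hab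
    push_cast at this
    rw [← this]
    exact w.asIdeal.add_mem (w.asIdeal.mul_mem_left _ hℓw) (w.asIdeal.mul_mem_left _ hd)
  exact w.isPrime.ne_top ((Ideal.eq_top_iff_one _).mpr h1)

omit [NumberField K] in
/-- `χ̃_f(I) = χ̃_g(I)` as soon as `f = g` on the primes dividing `I ≠ 0`. [folklore] -/
private theorem idealPow_congr_of_forall_le [NumberField K] {f g : HeightOneSpectrum (𝓞 K) → ℂ} {I : Ideal (𝓞 K)} (hI : I ≠ ⊥)
    (h : ∀ v : HeightOneSpectrum (𝓞 K), I ≤ v.asIdeal → f v = g v) : idealPow K f I = idealPow K g I := by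
  unfold idealPow
  refine finprod_congr fun v => ?_
  by_cases hc : (Associates.mk v.asIdeal).count (Associates.mk I).factors = 0
  · rw [hc, pow_zero, pow_zero]
  · rw [h v (Ideal.le_of_dvd ((Associates.count_ne_zero_iff_dvd hI v.irreducible).mp hc))]

/-- The primes of `(n)` are prime to `𝔪` when `n` is prime to `N𝔪` (quadratic field: `N((n)) = n²`). [folklore] -/
private theorem not_le_of_span_natCast_le (hK2 : Module.finrank ℚ K = 2) {𝔪 : Ideal (𝓞 K)} {n : ℕ}
    (hn : n.Coprime (Ideal.absNorm 𝔪)) {v : HeightOneSpectrum (𝓞 K)} (hv : Ideal.span {(n : 𝓞 K)} ≤ v.asIdeal) :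
    ¬ 𝔪 ≤ v.asIdeal := by
  intro h𝔪v
  have h1 : Ideal.absNorm v.asIdeal ∣ Ideal.absNorm 𝔪 := Ideal.absNorm_dvd_absNorm_of_le h𝔪v
  have h2 : Ideal.absNorm v.asIdeal ∣ n ^ 2 := by
    have h := Ideal.absNorm_dvd_absNorm_of_le hv
    rwa [show ((n : ℕ) : 𝓞 K) = ((n : ℤ) : 𝓞 K) by push_cast; rfl, absNorm_span_intCast hK2, Int.natAbs_natCast] at h
  have hne : Ideal.absNorm v.asIdeal ≠ 1 := by
    rw [Ne, Ideal.absNorm_eq_one_iff]; exact v.isPrime.ne_top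
  obtain ⟨r, hr, hrv⟩ := Nat.exists_prime_and_dvd hne
  have hrn : r ∣ n := hr.dvd_of_dvd_pow (hrv.trans h2)
  have : r ∣ Nat.gcd n (Ideal.absNorm 𝔪) := Nat.dvd_gcd hrn (hrv.trans h1)
  rw [hn] at this
  exact hr.one_lt.ne' (Nat.dvd_one.mp this)

/-- ★ **The Nebentypus clause transfers to a sharpened datum**: `ψ′` a Grössencharakter mod `𝔪′` of type `(σ, 0)` agreeing with `ψ` off `𝔪`,
`ψ̃((n)) = (d_K/n)·n` for odd `n` prime to `|d_K|·N𝔪` ⟹ the same for `ψ̃′` and odd `n` prime to `|d_K|·N𝔪′` (odd `n₁ ≡ n (mod 4|d_K|N𝔪′)` prime to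
`N𝔪`; ray relation mod `𝔪′`; `ψ′ = ψ` at the primes of `(n₁)`; `jacobiSym.mod_right`). [cite: Ribet1977Nebentypus, §3 (LNM 601, p. 34)] [cite: NeukirchANT1999, Ch. VII §6 Def. (6.1)] -/
theorem nebentypus_of_sharp [IsTotallyComplex K] (hK2 : Module.finrank ℚ K = 2) (σ : K →+* ℂ)
    {𝔪 𝔪' : Ideal (𝓞 K)} (h𝔪 : 𝔪 ≠ ⊥) (h𝔪' : 𝔪' ≠ ⊥) {ψ ψ' : HeightOneSpectrum (𝓞 K) → ℂ}
    (hψ' : IsGrossencharakter 𝔪' (embType σ) (embTypeConj σ) ψ')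
    (heq : ∀ v : HeightOneSpectrum (𝓞 K), ¬ 𝔪 ≤ v.asIdeal → ψ' v = ψ v)
    (hneb : ∀ n : ℕ, Odd n → n.Coprime ((NumberField.discr K).natAbs * Ideal.absNorm 𝔪) →
      idealPow K ψ (Ideal.span {(n : 𝓞 K)}) = (jacobiSym (NumberField.discr K) n : ℂ) * (n : ℂ) ^ (2 - 1)) :
    ∀ n : ℕ, Odd n → n.Coprime ((NumberField.discr K).natAbs * Ideal.absNorm 𝔪') →
      idealPow K ψ' (Ideal.span {(n : 𝓞 K)}) = (jacobiSym (NumberField.discr K) n : ℂ) * (n : ℂ) ^ (2 - 1) := by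
  intro n hn hcop
  set D : ℕ := (NumberField.discr K).natAbs with hDdef
  set M : ℕ := Ideal.absNorm 𝔪 with hMdef
  set M' : ℕ := Ideal.absNorm 𝔪' with hM'def
  have hM0 : M ≠ 0 := by rw [hMdef, Ne, Ideal.absNorm_eq_zero_iff]; exact h𝔪
  have hM'0 : M' ≠ 0 := by rw [hM'def, Ne, Ideal.absNorm_eq_zero_iff]; exact h𝔪'
  have hD0 : D ≠ 0 := Int.natAbs_ne_zero.mpr (NumberField.discr_ne_zero K)
  have hn0 : n ≠ 0 := hn.pos.ne'
  -- the moduli `L = 4 D M′` and `N = L M`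
  set L : ℕ := 4 * D * M' with hLdef
  have hL0 : L ≠ 0 := mul_ne_zero (mul_ne_zero (by norm_num) hD0) hM'0
  have hcopL : n.Coprime L := by
    have h4 : n.Coprime 4 := by
      rw [show (4 : ℕ) = 2 ^ 2 by norm_num]
      exact Nat.Coprime.pow_right 2 (Nat.coprime_two_right.mpr hn)
    exact Nat.Coprime.mul_right (Nat.Coprime.mul_right h4 (hcop.coprime_dvd_right (dvd_mul_right D M')))
      (hcop.coprime_dvd_right (dvd_mul_left M' D))
  set N : ℕ := L * M with hNdef
  haveI : NeZero N := ⟨mul_ne_zero hL0 hM0⟩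
  haveI : NeZero L := ⟨hL0⟩
  -- an odd `n₁ ≡ n (mod L)` prime to `N`
  obtain ⟨u, hu⟩ := ZMod.unitsMap_surjective (dvd_mul_right L M : L ∣ N) (ZMod.unitOfCoprime n hcopL)
  set n₁ : ℕ := (u : ZMod N).val with hn₁def
  have hn₁N : n₁.Coprime N := ZMod.val_coe_unit_coprime u
  have hmod : n₁ ≡ n [MOD L] := by
    have h1 := congrArg (fun x : (ZMod L)ˣ => (x : ZMod L)) hu
    simp only [ZMod.unitsMap_val, ZMod.coe_unitOfCoprime] at h1
    rw [← ZMod.natCast_val (u : ZMod N)] at h1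
    exact (ZMod.natCast_eq_natCast_iff _ _ _).mp h1
  have hn₁odd : Odd n₁ := by
    have h2 : n₁ ≡ n [MOD 2] := hmod.of_dvd ⟨2 * D * M', by rw [hLdef]; ring⟩
    rw [Nat.odd_iff, h2, ← Nat.odd_iff]; exact hn
  have hn₁0 : n₁ ≠ 0 := hn₁odd.pos.ne'
  have hn₁DM : n₁.Coprime (D * M) := hn₁N.coprime_dvd_right ⟨4 * M', by rw [hNdef, hLdef]; ring⟩
  have hn₁M' : n₁.Coprime M' := hn₁N.coprime_dvd_right ⟨4 * D * M, by rw [hNdef, hLdef]; ring⟩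
  -- `ψ̃((n₁)) = (d_K/n₁) n₁` and `ψ̃′((n₁)) = ψ̃((n₁))`
  have hψn₁ := hneb n₁ hn₁odd hn₁DM
  have hcongr : idealPow K ψ' (Ideal.span {(n₁ : 𝓞 K)}) = idealPow K ψ (Ideal.span {(n₁ : 𝓞 K)}) := by
    refine idealPow_congr_of_forall_le (by rw [Ne, Ideal.span_singleton_eq_bot]; exact_mod_cast hn₁0) fun v hv => heq v ?_
    exact not_le_of_span_natCast_le hK2 (hn₁DM.coprime_dvd_right (dvd_mul_left M D)) hv
  -- the ray relation mod `𝔪′` between `(n)` and `(n₁)`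
  have hsub : (n : 𝓞 K) - (n₁ : 𝓞 K) ∈ 𝔪' := by
    have hmodM' : n₁ ≡ n [MOD M'] := hmod.of_dvd ⟨4 * D, by rw [hLdef]; ring⟩
    obtain ⟨k, hk⟩ := Nat.modEq_iff_dvd.mp hmodM'
    have h1 : (n : 𝓞 K) - (n₁ : 𝓞 K) = (((n : ℤ) - (n₁ : ℤ) : ℤ) : 𝓞 K) := by push_cast; rfl
    rw [h1, hk, Int.cast_mul, Int.cast_natCast]
    exact Ideal.mul_mem_right _ _ (Ideal.absNorm_mem 𝔪')
  have hpos : ∀ φ : K →+* ℝ, 0 < φ ((n : 𝓞 K) : K) * φ ((n₁ : 𝓞 K) : K) := fun φ => by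
    rw [show ((n : 𝓞 K) : K) = (n : K) from rfl, show ((n₁ : 𝓞 K) : K) = (n₁ : K) from rfl, map_natCast, map_natCast]
    positivity
  have hrel := hψ'.idealPow_span_eq (n : 𝓞 K) (n₁ : 𝓞 K) (by exact_mod_cast hn0) (by exact_mod_cast hn₁0)
    (isCoprime_span_natCast_of_coprime_absNorm' hn₁M') hsub hpos
  rw [prod_embedding_zpow_embType] at hrel
  have hσ : σ (((n : 𝓞 K) : K) / ((n₁ : 𝓞 K) : K)) = (n : ℂ) / (n₁ : ℂ) := by
    rw [show ((n : 𝓞 K) : K) = (n : K) from rfl, show ((n₁ : 𝓞 K) : K) = (n₁ : K) from rfl, map_div₀, map_natCast, map_natCast]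
  -- `(d_K/n₁) = (d_K/n)` since `n₁ ≡ n (mod 4|d_K|)`
  have hJ : jacobiSym (NumberField.discr K) n₁ = jacobiSym (NumberField.discr K) n := by
    rw [jacobiSym.mod_right _ hn₁odd, jacobiSym.mod_right _ hn, ← hDdef]
    have h4 : n₁ ≡ n [MOD 4 * D] := hmod.of_dvd ⟨M', by rw [hLdef]⟩
    rw [h4]
  rw [hrel, hσ, hcongr, hψn₁, hJ]
  have hn₁C : (n₁ : ℂ) ≠ 0 := by exact_mod_cast hn₁0
  simp only [show (2 : ℕ) - 1 = 1 from rfl, pow_one]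
  field_simp

/-- ★ **The primes of `d_K` divide the modulus of a Grössencharakter with trivial Nebentypus** (`K` imaginary quadratic, type `(σ, 0)`, `𝔪 ≠ 0`,
`ψ̃((n)) = (d_K/n)·n` for odd `n` prime to `|d_K|·N𝔪`): otherwise, `w` being the ONLY prime over the ramified `ℓ ∣ d_K`, `ℓ ∤ N𝔪`; `ψ̃((m)) = κ(m)·m`
for `m` prime to `|d_K| N𝔪` (`κ` the Kronecker character) and `ψ̃((m)) = m` for `m ≡ 1 (mod N𝔪)` make `κ` trivial on the units `≡ 1 (mod gcd(|d_K|, N𝔪))`,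
i.e. factor through a proper divisor of its conductor `|d_K|`. [cite: Ribet1977Nebentypus, §3 (LNM 601, p. 34)] [cite: Cox2013, §1.C Lemma 1.14]
[cite: Marcus2018, Ch. 3 Thm. 25 and Thm. 34] -/
theorem le_asIdeal_of_discr_mem [IsTotallyComplex K] (hK2 : Module.finrank ℚ K = 2) (σ : K →+* ℂ)
    {𝔪 : Ideal (𝓞 K)} (h𝔪 : 𝔪 ≠ ⊥) {ψ : HeightOneSpectrum (𝓞 K) → ℂ}
    (hψ : IsGrossencharakter 𝔪 (embType σ) (embTypeConj σ) ψ)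
    (hneb : ∀ n : ℕ, Odd n → n.Coprime ((NumberField.discr K).natAbs * Ideal.absNorm 𝔪) →
      idealPow K ψ (Ideal.span {(n : 𝓞 K)}) = (jacobiSym (NumberField.discr K) n : ℂ) * (n : ℂ) ^ (2 - 1))
    {w : HeightOneSpectrum (𝓞 K)} (hw : ((NumberField.discr K : ℤ) : 𝓞 K) ∈ w.asIdeal) : 𝔪 ≤ w.asIdeal := by
  by_contra hnot
  set D : ℕ := (NumberField.discr K).natAbs with hDdef
  set M : ℕ := Ideal.absNorm 𝔪 with hMdef
  have hM0 : M ≠ 0 := by rw [hMdef, Ne, Ideal.absNorm_eq_zero_iff]; exact h𝔪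
  have hD0 : D ≠ 0 := Int.natAbs_ne_zero.mpr (NumberField.discr_ne_zero K)
  have hD2 : 2 < D := by
    have h := NumberField.abs_discr_gt_two (K := K) (by rw [hK2]; norm_num)
    have : (2 : ℤ) < (D : ℤ) := by rw [hDdef, Int.natCast_natAbs]; exact h
    exact_mod_cast this
  haveI : NeZero D := ⟨hD0⟩
  -- the rational prime `ℓ` under `w`; `ℓ ∣ d_K`
  set v : HeightOneSpectrum (𝓞 ℚ) := w.under (𝓞 ℚ) with hvdef
  set ℓ : ℕ := (primesEquiv v : ℕ) with hℓdef
  have hℓ : ℓ.Prime := (primesEquiv v).2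
  have hℓw : (ℓ : 𝓞 K) ∈ w.asIdeal := (under_eq_iff_natCast_primesEquiv_mem w v).mp rfl
  have hℓd : (ℓ : ℤ) ∣ NumberField.discr K := natCast_dvd_of_mem_of_intCast_mem hℓ hℓw hw
  -- `w` is the only prime over `ℓ`
  obtain ⟨w₀, -, huniq, -⟩ := WeierstrassCurve.exists_unique_place_of_dvd_discr K hK2 v (by rw [← hℓdef]; exact hℓd)
  have hww₀ : w = w₀ := huniq w (by rw [← HeightOneSpectrum.under_asIdeal])
  -- hence `ℓ ∤ N𝔪`
  have hℓM : ¬ ℓ ∣ M := by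
    intro h
    obtain ⟨u, hu, hℓu⟩ := exists_prime_le_of_prime_dvd_absNorm h𝔪 hℓ h
    have hℓu' := natCast_mem_of_dvd_absNorm' hℓ u hℓu
    have huv : u.under (𝓞 ℚ) = v := (under_eq_iff_natCast_primesEquiv_mem u v).mpr hℓu'
    have huw₀ : u = w₀ := huniq u (by rw [← HeightOneSpectrum.under_asIdeal, huv])
    rw [huw₀, ← hww₀] at hu
    exact hnot hu
  -- the Kronecker character, primitive of conductor `D`
  obtain ⟨κ, hprim, -, -, hκJ, -⟩ := exists_kroneckerChar_odd_jacobiSym_dedekindZeta (K := K) hK2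
  -- `ψ` in the weight-`2` currency of `CMNewformGamma0NebentypusProofs`
  have hp : (fun x : InfinitePlace K => (((2 : ℕ) : ℤ) - 1) * embType σ x) = embType σ := by
    funext x; simp
  have hq : (fun x : InfinitePlace K => (((2 : ℕ) : ℤ) - 1) * embTypeConj σ x) = embTypeConj σ := by
    funext x; simp
  have hψ₂ : IsGrossencharakter 𝔪 (fun x : InfinitePlace K => (((2 : ℕ) : ℤ) - 1) * embType σ x)
      (fun x : InfinitePlace K => (((2 : ℕ) : ℤ) - 1) * embTypeConj σ x) ψ := by
    rw [hp, hq]; exact hψ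
  -- `κ` factors through `g = gcd(D, M)`
  have hfac : κ.FactorsThrough (Nat.gcd D M) := by
    refine (DirichletCharacter.factorsThrough_iff_ker_unitsMap (Nat.gcd_dvd_left D M)).mpr fun x hx => ?_
    rw [MonoidHom.mem_ker] at hx ⊢
    have ha : (x : ZMod D).val ≡ 1 [MOD Nat.gcd D M] := by
      rwa [Units.ext_iff, ZMod.unitsMap_val, ← ZMod.natCast_val, Units.val_one, ← Nat.cast_one,
        ZMod.natCast_eq_natCast_iff] at hx
    obtain ⟨z, hzD, hzM⟩ : ∃ z : ℕ, z ≡ (x : ZMod D).val [MOD D] ∧ z ≡ 1 [MOD M] :=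
      let c := Nat.chineseRemainder' ha; ⟨c.1, c.2.1, c.2.2⟩
    have hxcop : (x : ZMod D).val.Coprime D := ZMod.val_coe_unit_coprime x
    have hzcopD : z.Coprime D := by
      unfold Nat.Coprime at hxcop ⊢
      rw [hzD.gcd_eq, hxcop]
    have hzcopM : z.Coprime M := by
      unfold Nat.Coprime
      rw [hzM.gcd_eq, Nat.gcd_one_left]
    have hzcop : z.Coprime (D * M) := Nat.Coprime.mul_right hzcopD hzcopM
    have hz0 : z ≠ 0 := by
      rintro rfl
      rw [Nat.coprime_zero_left] at hzcopD
      omega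
    -- `ψ̃((z)) = κ(z) · z`
    have h1 := idealPow_span_natCast_eq_kroneckerChar_mul_pow hK2 σ (k := 2) (by norm_num) hκJ hψ₂ hneb hzcop
    -- `ψ̃((z)) = z` by the ray relation with `(1)`
    have hsub : (z : 𝓞 K) - 1 ∈ 𝔪 := by
      obtain ⟨k, hk⟩ := Nat.modEq_iff_dvd.mp hzM
      have h1' : (z : 𝓞 K) - 1 = -((((1 : ℕ) : ℤ) - (z : ℤ) : ℤ) : 𝓞 K) := by push_cast; ring
      rw [h1', hk, Int.cast_mul, Int.cast_natCast]
      exact neg_mem_iff.mpr (Ideal.mul_mem_right _ _ (Ideal.absNorm_mem 𝔪))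
    have hpos : ∀ φ : K →+* ℝ, 0 < φ ((z : 𝓞 K) : K) * φ ((1 : 𝓞 K) : K) := fun φ => by
      simp only [map_natCast, map_one]
      positivity
    have h2 := hψ.idealPow_span_eq (z : 𝓞 K) 1 (by exact_mod_cast hz0) one_ne_zero
      (by rw [Ideal.span_singleton_one, ← Ideal.one_eq_top]; exact isCoprime_one_left) hsub hpos
    rw [prod_embedding_zpow_embType, Ideal.span_singleton_one, idealPow_top, one_mul] at h2
    simp only [map_natCast, map_one, div_one] at h2
    have hκz : κ (z : ZMod D) = 1 := by
      rw [h2, show (2 : ℕ) - 1 = 1 from rfl, pow_one] at h1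
      have hzC : (z : ℂ) ≠ 0 := by exact_mod_cast hz0
      have : κ (z : ZMod D) * (z : ℂ) = 1 * (z : ℂ) := by rw [one_mul]; exact h1.symm
      exact mul_right_cancel₀ hzC this
    have hxz : (x : ZMod D) = ((z : ℕ) : ZMod D) := by
      rw [← ZMod.natCast_zmod_val (x : ZMod D)]
      exact ((ZMod.natCast_eq_natCast_iff _ _ _).mpr hzD).symm
    rw [Units.ext_iff, MulChar.coe_toUnitHom, Units.val_one, hxz, hκz]
  -- so the conductor of `κ` is at most `gcd(D, M)`: contradiction with primitivity unless `D ∣ M`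
  have hle : κ.conductor ≤ Nat.gcd D M := Nat.sInf_le ((DirichletCharacter.mem_conductorSet_iff κ).mpr hfac)
  rw [DirichletCharacter.isPrimitive_def] at hprim
  rw [hprim] at hle
  have hgcd : Nat.gcd D M = D := le_antisymm (Nat.gcd_le_left M (Nat.pos_of_ne_zero hD0)) hle
  have hDM : D ∣ M := Nat.gcd_eq_left_iff_dvd.mp hgcd
  exact hℓM ((Int.natCast_dvd.mp hℓd).trans hDM)

end Sharp

/-- ★★ **Every small-image X7 pair carries an ARITHMETIC HALF WITH A SHARP MODULUS (class-wide, hypothesis-free).** `exists_arithmeticHalf_classwide`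
VERBATIM (binders `K σ 𝔪 ψ e`, clauses `hK2 htc h𝔪 hnop hpD hbad hψG hneb htrace hv hpd hdK`, datum `Φ k e₀ …`) for the SHARPENED pair, with TWO new conjuncts
before `∃ Φ k e₀ …`: (prim′) `∀ χ : HeckeCharacter K, (∀ᶠ v in cofinite, χ(ϖ_v) = ψ v) → ∀ w, 𝔪 ≤ w.asIdeal ↔ ¬ χ.IsUnramifiedAt w` — the primes of `𝔪` are
EXACTLY the ramified places of every idelic realisation of `ψ` (so the road's avatar `θ` is ramified at every `w ∣ 𝔪`, `w ∤ p`); (dK′) `∀ w, ↑d_K ∈ w.asIdeal →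
𝔪 ≤ w.asIdeal`. Proof: `exists_arithmeticHalf_classwide` + `IsGrossencharakter.exists_sharp`; `hpD`/`hbad` via `ℓ ∣ N𝔪′ ⇒ ℓ ∣ N𝔪`; `hneb` by §1; `htrace`
unchanged (`ψ′ = ψ` above good `ℓ ≠ p`); (dK′) by §2. [cite: Serre1972, §2.2 Prop. 14, §4.2 c), §5.2 (iv)] [cite: Ribet1977Nebentypus, §3 Thm. 3.6]
[cite: NeukirchANT1999, Ch. VII §6 (6.11)–(6.14)] -/
theorem exists_arithmeticHalf_classwide_sharp (W : WeierstrassCurve ℚ) [W.IsElliptic] [W.IsGloballyMinimal] (p : ℕ) [Fact p.Prime]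
    (hp2 : p ≠ 2) (hX : ClassX7 W p) (hs : ¬ Surj W p) :
    ∃ (K : Type) (_ : Field K) (_ : NumberField K) (σ : K →+* ℂ) (𝔪 : Ideal (𝓞 K))
      (ψ : HeightOneSpectrum (𝓞 K) → ℂ) (e : PadicAlgCl p ≃+* ℂ),
      Module.finrank ℚ K = 2 ∧ IsTotallyComplex K ∧ 𝔪 ≠ ⊥ ∧
      (∀ I : Ideal (𝓞 K), Ideal.absNorm I ≠ p) ∧ ¬ p ∣ (NumberField.discr K).natAbs * Ideal.absNorm 𝔪 ∧
      (∀ (ℓ : ℕ) [Fact ℓ.Prime], ℓ ∣ (NumberField.discr K).natAbs * Ideal.absNorm 𝔪 → ¬ W.HasGoodReductionAtPrime ℓ) ∧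
      IsGrossencharakter 𝔪 (embType σ) (embTypeConj σ) ψ ∧
      (∀ n : ℕ, Odd n → n.Coprime ((NumberField.discr K).natAbs * Ideal.absNorm 𝔪) →
        idealPow K ψ (Ideal.span {(n : 𝓞 K)}) = (jacobiSym (NumberField.discr K) n : ℂ) * (n : ℂ) ^ (2 - 1)) ∧
      (∀ (ℓ : ℕ) [Fact ℓ.Prime], ℓ ≠ p → W.HasGoodReductionAtPrime ℓ →
        ‖e.symm (∑ᶠ (w : HeightOneSpectrum (𝓞 K)) (_ : Ideal.absNorm w.asIdeal = ℓ), ψ w) -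
          (W.frobeniusTrace ℓ : PadicAlgCl p)‖ < 1) ∧
      (∃ v : HeightOneSpectrum (𝓞 K), v.asIdeal = Ideal.span {(p : 𝓞 K)} ∧ Nat.card (𝓞 K ⧸ v.asIdeal) = p ^ 2) ∧
      ¬ (p : ℤ) ∣ NumberField.discr K ∧
      (∀ (ℓ : ℕ) [Fact ℓ.Prime], (ℓ : ℤ) ∣ NumberField.discr K → ¬ W.HasGoodReductionAtPrime ℓ) ∧
      -- (prim′) SHARP SUPPORT: the primes of `𝔪` are exactly the ramified places of every idelic realisation of `ψ`
      (∀ χ : HeckeCharacter K, (∀ᶠ v in cofinite, χ.valueAtUniformizer v = ψ v) →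
        ∀ w : HeightOneSpectrum (𝓞 K), 𝔪 ≤ w.asIdeal ↔ ¬ χ.IsUnramifiedAt w) ∧
      -- (dK′) every ramified prime of `K` divides `𝔪`
      (∀ w : HeightOneSpectrum (𝓞 K), ((NumberField.discr K : ℤ) : 𝓞 K) ∈ w.asIdeal → 𝔪 ≤ w.asIdeal) ∧
      ∃ (Φ : Multiplicative (AddAut (geomTorsion W p)) ≃* GL (Fin 2) (ZMod p))
        (k : Subalgebra (ZMod p) (Matrix (Fin 2) (Fin 2) (ZMod p))) (e₀ : geomTorsion W p ≃+ (Fin 2 → ZMod p)),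
        (∀ (g : Multiplicative (AddAut (geomTorsion W p))) (x : geomTorsion W p),
          e₀ (Multiplicative.toAdd g x) = ((Φ g : GL (Fin 2) (ZMod p)) : Matrix (Fin 2) (Fin 2) (ZMod p)) *ᵥ e₀ x) ∧
        IsField k ∧ Module.finrank (ZMod p) k = 2 ∧
        (letI : Module (ZMod p) (geomTorsion W p) := AddSubgroup.torsionBy.zmodModule
          ∀ g : Multiplicative (AddAut (geomTorsion W p)),
            Matrix.trace ((Φ g : GL (Fin 2) (ZMod p)) : Matrix (Fin 2) (Fin 2) (ZMod p)) =
              LinearMap.trace (ZMod p) (geomTorsion W p) ((Multiplicative.toAdd g).toAddMonoidHom.toZModLinearMap p)) ∧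
        (galoisRepTorsion W p).range.map Φ.toMonoidHom ≤
          Subgroup.normalizer (Serre1972.unitGroup k : Set (GL (Fin 2) (ZMod p))) ∧
        ((Serre1972.unitGroup k).comap Φ.toMonoidHom).comap (galoisRepTorsion W p) ≤
          (absGaloisRestrict ℚ K).toMonoidHom.range ∧
        (∀ τ : absoluteGaloisGroup K, Φ (galoisRepTorsion W p (absGaloisRestrict ℚ K τ)) ∈ Serre1972.unitGroup k) := by
  classical
  have hp : p.Prime := Fact.out
  obtain ⟨K, _, _, σ, 𝔪, ψ, e, hK2, htc, h𝔪, hnop, hpD, hbad, hψG, hneb, htrace, hv, hpd, hdK, Φ, k, e₀, he₀, hk, h2, htr,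
    hGN, hUle, hKU⟩ := exists_arithmeticHalf_classwide W p hp2 hX hs
  haveI : IsTotallyComplex K := htc
  -- sharpen the modulus
  obtain ⟨𝔪', ψ', h𝔪', hsupp, hnorm, hψ'G, heq, hsharp⟩ := hψG.exists_sharp h𝔪
  -- a rational prime of `|d_K| N𝔪′` is one of `|d_K| N𝔪`
  have hdiv : ∀ ℓ : ℕ, ℓ.Prime → ℓ ∣ (NumberField.discr K).natAbs * Ideal.absNorm 𝔪' →
      ℓ ∣ (NumberField.discr K).natAbs * Ideal.absNorm 𝔪 := by
    intro ℓ hℓ h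
    rcases (Nat.Prime.dvd_mul hℓ).mp h with h1 | h1
    · exact h1.mul_right _
    · exact (hnorm ℓ hℓ h1).mul_left _
  have hpD' : ¬ p ∣ (NumberField.discr K).natAbs * Ideal.absNorm 𝔪' := fun h => hpD (hdiv p hp h)
  have hbad' : ∀ (ℓ : ℕ) [Fact ℓ.Prime], ℓ ∣ (NumberField.discr K).natAbs * Ideal.absNorm 𝔪' →
      ¬ W.HasGoodReductionAtPrime ℓ := fun ℓ _ h => hbad ℓ (hdiv ℓ Fact.out h)
  have hneb' := nebentypus_of_sharp hK2 σ h𝔪 h𝔪' hψ'G heq hneb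
  -- above a good prime `ℓ ≠ p` the values are unchanged
  have htrace' : ∀ (ℓ : ℕ) [Fact ℓ.Prime], ℓ ≠ p → W.HasGoodReductionAtPrime ℓ →
      ‖e.symm (∑ᶠ (w : HeightOneSpectrum (𝓞 K)) (_ : Ideal.absNorm w.asIdeal = ℓ), ψ' w) -
        (W.frobeniusTrace ℓ : PadicAlgCl p)‖ < 1 := by
    intro ℓ _ hℓp hgood
    have hℓ : ℓ.Prime := Fact.out
    have hcongr : (∑ᶠ (w : HeightOneSpectrum (𝓞 K)) (_ : Ideal.absNorm w.asIdeal = ℓ), ψ' w) =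
        ∑ᶠ (w : HeightOneSpectrum (𝓞 K)) (_ : Ideal.absNorm w.asIdeal = ℓ), ψ w := by
      refine finsum_congr fun w => finsum_congr fun hw => heq w fun hle => ?_
      have h1 : ℓ ∣ Ideal.absNorm 𝔪 := hw ▸ Ideal.absNorm_dvd_absNorm_of_le hle
      exact hbad ℓ (h1.mul_left _) hgood
    rw [hcongr]
    exact htrace ℓ hℓp hgood
  exact ⟨K, inferInstance, inferInstance, σ, 𝔪', ψ', e, hK2, htc, h𝔪', hnop, hpD', (fun ℓ _ h => hbad' ℓ h), hψ'G, hneb',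
    (fun ℓ _ hℓp hgood => htrace' ℓ hℓp hgood), hv, hpd, hdK, hsharp,
    (fun w hw => le_asIdeal_of_discr_mem hK2 σ h𝔪' hψ'G hneb' hw), Φ, k, e₀, he₀, hk, h2, htr, hGN, hUle, hKU⟩

end Summit.BirchSwinnertonDyer.BirchSwinnertonDyer.Theorems.SmallImageLambdaLowerThreeNsThetaPartner

end
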